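import Summits.NavierStokesRegularity.NavierStokesRegularity.Theses.HodographBetchov
import Summits.NavierStokesRegularity.NavierStokesRegularity.Theorems.HodographBetchovClassBudgetsRegulariseStubEnstrophyBound
import Summits.NavierStokesRegularity.NavierStokesRegularity.Theorems.HodographBetchovClassBudgetsRegulariseStubEnstrophyContinuation
import Summits.NavierStokesRegularity.NavierStokesRegularity.Theorems.HodographBetchovClassBudgetsRegulariseStubDatumFrame

/-!
# Crux `HodographBetchov.ClassBudgetsRegularise` (stmt-NavierStokesRegularity-16863) — PROVED

Route `HodographBetchov` of `NavierStokesRegularity`, crux 4 (rank 4, the deciding hypothesis of the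
route's `closes`): the BETCHOV–MILLER BRIDGE in Clay (A)-form — for every `ν > 0` and every Clay datum
`u₀` (smooth, divergence free, rapidly decaying): if along EVERY classical solution `(u, p)` of the
unforced Navier–Stokes system on `ℝ³ × [0, T)`, every `T > 0`, which is Leray–Hopf from `u 0 = u₀`,
SOME speed level `l > 0` carries both class budgets (the slow-class production bound and the
fast-class Miller–Serrin squeeze, verbatim the conclusions of cruxes `SlowClassProduction` and
`FastClassSqueeze` at `l`), then `u₀` launches a global smooth solution with bounded energy.

The proof is the composition of the registered birth skeleton `Cruxes/ClassBudgetsRegularise/Lines/birth.lean`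
(`classBudgetsRegularise_assembly`, pure logic) with its three stubs, all landed as theorems:

* `Birth.stub_classBudgetEnstrophyBound` (`…StubEnstrophyBound.lean`; the load-bearing one, resting
  on `…Algebra`, `…Hodograph`, `…KeyEstimate`, `…Transport`, `…Production`, `…Slice`, `…Slab`):
  the class budgets at one level bound the enstrophy on `[0, T)` — Betchov's split
  `⟪ω, ∇u ω⟫ − 4 det ∇u = −4 det S` and the decay-free velocity-class null-Lagrangian identities
  `∫_{‖u‖≤l} det ∇u = ∫ det ∇u = 0` turn the fast-class production into `−4∫_F det S ≤ 2∫_F λ₂⁺|∇u|²`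
  (Miller's Lemma 5.1 in the two-frame form), Miller's Hölder–Gagliardo–Nirenberg–Young step absorbs
  it, the slow class pays with its time-integrated production, Grönwall in Tao's class,
  identification with the given solution by Majda–Bertozzi uniqueness and the continuation method;
* `Birth.stub_enstrophyContinuation` (`…StubEnstrophyContinuation.lean`): bounded enstrophy continues
  the solution past `T` (Tao persistence + `hasSobolevExtensionPast_of_uniform_H1_bound`);
* `Birth.stub_datumFrame` (`…StubDatumFrame.lean`): per-datum no blow-up ⇒ Clay (A) for the datum
  (the tree's `NoBlowupToClay` frame run for one datum).

References: E. Miller, Arch. Ration. Mech. Anal. 235 (2020) = arXiv:1710.05569, Thm. 1.1,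
Lemma 5.1; R. Betchov, J. Fluid Mech. 1 (1956); T. Tao, Anal. PDE 6 (2013); J. Leray (1934);
C. Fefferman, Clay problem description (2000/2006), (A).
-/

noncomputable section

open Set MeasureTheory Filter Topology Function
open scoped ENNReal NNReal InnerProductSpace

-- the summit and its single sub-problem share the name (CONVENTIONS §1), as in every Theorems file
set_option linter.dupNamespace false

namespace Summit.NavierStokesRegularity.NavierStokesRegularity.Theorems

open Literature.Analysis Literature.Analysis.FluidPDE

/-- **Crux `ClassBudgetsRegularise` of route `HodographBetchov` (stmt-NavierStokesRegularity-16863),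
proved.** For every `ν > 0` and every Clay datum `u₀`: if along every classical solution of the
unforced Navier–Stokes system on every `[0, T)` which is Leray–Hopf from `u 0 = u₀` some speed level
carries both the slow-class production bound and the fast-class squeeze, then `u₀` launches a
global smooth solution with bounded energy (Fefferman's (A) for `u₀`). Proof: the birth skeleton's
assembly — hand the per-datum frame (`Birth.stub_datumFrame`) the no-blow-up clause obtained, for
each classical Leray–Hopf `(u, p)` on `[0, T)` with `u 0 = u₀`, from the budget hypothesis (one
level `l` with both budgets), the Betchov–Miller enstrophy bound
(`Birth.stub_classBudgetEnstrophyBound`) and the `H¹` continuation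
(`Birth.stub_enstrophyContinuation`). [cite: Miller2019, Thm 1.1 (proof of Thm 5.2) and Lemma 5.1] -/
theorem classBudgetsRegularise_proof :
    Summit.NavierStokesRegularity.NavierStokesRegularity.Theses.HodographBetchov.ClassBudgetsRegularise := by
  unfold Summit.NavierStokesRegularity.NavierStokesRegularity.Theses.HodographBetchov.ClassBudgetsRegularise
  intro ν hν u₀ hs hd hdec hbud
  refine ClassBudgetsRegularise.Birth.stub_datumFrame ν hν u₀ hs hd hdec ?_
  intro T hT u p hcl hLH h0
  -- the budget hypothesis supplies ONE level carrying both class budgets along `(u, p)`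
  obtain ⟨l, hl, hslow, hfast⟩ := hbud T hT u p hcl hLH h0
  -- the datum of `u` is the Clay datum, hence rapidly decaying
  have hdec0 : HasRapidSpatialDecay (u 0) := by rw [h0]; exact hdec
  -- stub 1 bounds the enstrophy on `[0, T)`, stub 2 continues the solution past `T`
  exact ClassBudgetsRegularise.Birth.stub_enstrophyContinuation ν T hν hT u p hcl hLH hdec0
    (ClassBudgetsRegularise.Birth.stub_classBudgetEnstrophyBound ν T hν hT u p hcl hLH hdec0 l hl
      hslow hfast)

end Summit.NavierStokesRegularity.NavierStokesRegularity.Theorems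

end
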